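import Mathlib
import Summits.ValiantsHypothesis.ValiantsHypothesis.Theorems.LacunarySymmetroidMatrixDescartesCensusDefs

/-!
# `MatrixDescartes` — census vocabulary: the LOCAL (multiplicity) column `LocalRootLawAt`

HONEST FRAMING.  Definitions-only companion of the census frame for the crux
`Summit.ValiantsHypothesis.ValiantsHypothesis.Theses.LacunarySymmetroid.MatrixDescartes` (ledger item
`stmt-ValiantsHypothesis-18050`, route `LacunarySymmetroid`).  Nothing is proved or claimed here; in particular
nothing about the crux, about the cell's Conjecture B (`KPlusLogSqLaw`), or about `VP ≠ VNP`.

Provenance: crux-idea «local-multiplicity-law» (ideator seat val-idea-4, 2026-08-27; tree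
`Cruxes/MatrixDescartes/Ideas/local-multiplicity-law.md`; both critics PASS-WITH-PRICE, tier INSTRUMENT/RECORD),
whose price is one helper task: these definitions beside `RealRootLawAt` plus the rows `stub_localDescartes`,
`stub_local_2_3`, `stub_local_2_4_record` (companion file `LacunarySymmetroidMatrixDescartesLocalMultiplicity.lean`).

The census row `RealRootLawAt m K B` (`LacunarySymmetroidMatrixDescartesCensusDefs.lean`) counts DISTINCT real zeros
of the determinant of a `K`-term real symmetric `m × m` lacunary pencil `F = ∑ l, X ^ (d l) • S l`.  The LOCAL column
replaces that count by the ORDER OF VANISHING of `det F` at the point `t = 1` — the multiplicity half of every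
Khovanskii–Rolle count (for one `K`-nomial it is `K − 1`, Pólya–Szegő, *Problems and Theorems in Analysis* II,
Part V §6).  `t = 1` is without loss of generality for every non-zero `t₀`: `t ↦ t₀ u` stays inside the format
(the signs / sizes of `t₀ ^ (d l)` are absorbed into the `S l`).  The zero polynomial is excluded explicitly
(Mathlib's `rootMultiplicity t 0 = 0` would make the guard redundant; it is kept so that rows read as printed on the
card).

Contents (all `def … : Prop` or plain definitions, verbatim from the ideator's sketch
`pub/ideators/val-idea-4/lines/line-local-multiplicity.lean`, sha16 `d2ec2934628e718a`):
* `pencilDet d S` — the determinant polynomial of the pencil, the term inside `RealRootLawAt` verbatim;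
* `LocalRootLawAt m K B` — the local row «`μ(m, K) ≤ B`»;
* `LocalParamLaw` — the card's PARAMETER-COUNT law candidate «`μ(m,K) ≤ K · m(m+1)/2`» (a conjecture of the card,
  typed with the UNREDUCED constant; the critics book it as an ASIDE only, never in a `closes` chain);
* `LocalKPlusLogSqLaw` — the local twin of Conjecture B (same shape as `KPlusLogSqLaw` with the distinct-root count
  replaced by `rootMultiplicity 1`; logically independent of it as far as anyone knows).
-/

-- `Summit.ValiantsHypothesis.ValiantsHypothesis.…` repeats a component by the D-0017 layout
-- (single-conjunct summit), which the `dupNamespace` linter flags; the name is mandated.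
set_option linter.dupNamespace false

namespace Summit.ValiantsHypothesis.ValiantsHypothesis.Theorems.LacunarySymmetroidMatrixDescartes

/-- **The determinant polynomial of a lacunary pencil.**  For exponents `d : Fin K → ℕ` and real `m × m`
matrices `S l`, `pencilDet d S = det (∑ l, X ^ (d l) • S l)` — literally the polynomial whose roots the census row
`RealRootLawAt` and the crux `MatrixDescartes` count (symmetry of the `S l` is NOT part of the definition; rows add
it as a hypothesis). [folklore] -/
noncomputable def pencilDet {m K : ℕ} (d : Fin K → ℕ) (S : Fin K → Matrix (Fin m) (Fin m) ℝ) :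
    Polynomial ℝ :=
  Matrix.det (∑ l, ((Polynomial.X : Polynomial ℝ) ^ d l) • (S l).map Polynomial.C)

/-- **Local census row «`μ(m, K) ≤ B`».**  `LocalRootLawAt m K B`: for every exponent vector `d : Fin K → ℕ` and all
real symmetric `m × m` matrices `S l`, if the pencil determinant `pencilDet d S` is not the zero polynomial then it
vanishes at `t = 1` to order at most `B` (`Polynomial.rootMultiplicity 1`).  The local census of the card is
`μ(m, K) = min {B | LocalRootLawAt m K B}`; refuted rows are `¬ LocalRootLawAt m K B`.  (`t = 1` is w.l.o.g. among
non-zero points: `t ↦ t₀ u` rescales inside the format.) [folklore] -/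
def LocalRootLawAt (m K B : ℕ) : Prop :=
  ∀ (d : Fin K → ℕ) (S : Fin K → Matrix (Fin m) (Fin m) ℝ), (∀ l, (S l).IsSymm) →
    pencilDet d S ≠ 0 → (pencilDet d S).rootMultiplicity 1 ≤ B

/-- **The card's PARAMETER-COUNT law candidate** (crux-idea «local-multiplicity-law», val-idea-4, 2026-08-27; a
CONJECTURE of the card, typed as a named `Prop`, never asserted; NOT a published result; booked by the critics as an
ASIDE, never in a `closes` chain).  Text of the card: "the order of vanishing never exceeds the number of free real
parameters of the format, `K · dim Sym_m = K · m(m+1)/2`."  Typed with the UNREDUCED constant `K * (m * (m + 1) / 2)`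
(natural-number division is exact here); the card's sharper prose value `K · m(m+1)/2 − m²` is NOT what is typed.
Evidence recorded on the card: `μ(2,3) = 5 ≤ 9`, `μ(2,4; d) ≤ 8` on the census record supports (rank certificate,
`stub_local_2_4_record`), generic dimension count `μ(2,K) ≈ 3K − 4`; vacuous (≥ the Descartes ceiling
`C(m+K−1, m) − 1`) at every format the census has decided, content from `(2,6)` on.  Why it might fail (card): a
Vandermonde-resonant support could meet the low-rank Gram locus non-transversally.
[conjecture of the card; no citation exists] -/
def LocalParamLaw : Prop :=
  ∀ m K : ℕ, LocalRootLawAt m K (K * (m * (m + 1) / 2))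

/-- **The LOCAL twin of the cell's Conjecture B** (crux-idea «local-multiplicity-law», val-idea-4, 2026-08-27; a
CONJECTURE-SHAPED statement typed as a named `Prop`, never asserted; NOT a published result): `KPlusLogSqLaw` with the
distinct-root count `roots.toFinset.card` replaced by the order of vanishing at `t = 1` — some absolute `C : ℕ` makes
every format `(m, K)` satisfy the local row with bound `2 ^ (C * (K + (Nat.log 2 m) ^ 2))`.  Logically independent of
`KPlusLogSqLaw` as far as anyone knows (neither count dominates the other); implied by `LocalParamLaw` by arithmetic
(card stub `stub_localKPlusLogSq_of_localParam`, not landed here). [conjecture of the card; no citation exists] -/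
def LocalKPlusLogSqLaw : Prop :=
  ∃ C : ℕ, ∀ m K : ℕ, LocalRootLawAt m K (2 ^ (C * (K + Nat.log 2 m ^ 2)))

end Summit.ValiantsHypothesis.ValiantsHypothesis.Theorems.LacunarySymmetroidMatrixDescartes
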